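import Summits.QuantumFields.QCD.Theses.GapBuysCauchyRate
import Summits.QuantumFields.QCD.Theorems.QuarksAsStableActionStableActionBridgeStubMesonReflect
import Literature.MathematicalPhysics.QuantumFieldTheory.QCDTimeReflectionProofs

/-!
# Stub `stub_mesonTwoPointReal` (W7b) of line `birth`, crux `GapBuysCauchyRate.LadderCauchyRate`
(item stmt-QuantumFields-17307, route route-QuantumFields-GapBuysCauchyRate, sub-problem QCD)

What is proved: GIVEN the reflection symmetry of the time-periodic quark Boltzmann factor under
the torus site reflection `Θ_T` (`Θ_T e^{−ψ̄D(U)ψ} = e^{−ψ̄D(Θ'U)ψ}`, the hypothesis — stub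
W7a), for every flavour number `N_f`, every `QCDScheme`, every step `k`, every flavour pair `f g`
and every real test function `f₀`, the lattice two-point function of the smeared meson field
`P = pseudoRe f g` on the reflected pair `(Θf₀, f₀)` is REAL: `Im ⟨Φ_k^P(Θf₀) Φ_k^P(f₀)⟩ = 0`.

How (the Osterwalder–Seiler reflection argument, Montvay–Münster §4.2.3, exactly as carried out
in the tree for the antiperiodic functional in `WilsonQCDSiteReflectionPositivityAP_im`):
* `Θ_T P_{fg}(x) = P_{gf}(θx)` (tree: `torusTheta_pseudoscalarBilinear`, `γ₀ (iγ₅)† γ₀ = iγ₅`),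
  so the (gauge-field independent) `pseudoRe` insertion obeys `Θ_T O(x) = O(θ₀x)`
  (`torusTheta_insertion_pseudoRe`), and the smeared field — a real-coefficient sum over the
  `θ₀`-symmetric box `{−L,…,L}⁴` — obeys `Θ_T Φ^P(φ) = Φ^P(Θφ)`
  (`torusTheta_smearedInsertion`: `Θ_T` is antilinear, `(Θφ)(a x) = φ(a θ₀x)`, reindex by `θ₀`).
* `Θ_T` is antimultiplicative, `ΘΘf₀ = f₀`, and the even Boltzmann factor is central, so
  `Θ_T (Φ(Θf₀) Φ(f₀) e^{−ψ̄D(U)ψ}) = Φ(Θf₀) Φ(f₀) e^{−ψ̄D(Θ'U)ψ}`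
  (`torusTheta_mesonIntegrand`).
* `∫dψ̄dψ ∘ Θ_T = c · conj ∘ ∫dψ̄dψ` (`fermiIntegral_torusTheta`, `c = thetaBerezinConst`) and
  Wilson's measure is `Θ'`-invariant on every torus (`integral_comp_negReflect_eq`); hence the
  numerator `N` and the denominator `D` of `qcdLatticeSchwinger` satisfy `N = c · conj N`,
  `D = c · conj D` (`integral_fermiIntegral_eq_const_mul_conj`), and `N / D` is real
  (`div_im_eq_zero_of_eq_mul_conj`, junk branches `c = 0`, `D = 0` included).
Sources: K. Osterwalder, E. Seiler, Ann. Phys. 110 (1978) 440, §2; I. Montvay, G. Münster,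
*Quantum Fields on a Lattice* (CUP 1994) §4.2.3 (4.90)–(4.99), §5.1 (meson fields).

Pure theorem file (no definitions): the registered stub signature, proved in tree vocabulary.
-/

noncomputable section

namespace Summit.QuantumFields.QCD.Cruxes.LadderCauchyRate.Birth

open scoped BigOperators Topology ComplexConjugate
open MeasureTheory Filter
open Literature.MathematicalPhysics.AQFT Literature.Probability.LatticeModels
  Literature.MathematicalPhysics.QuantumLattice Literature.MathematicalPhysics.QuantumFieldTheory
open Summit.QuantumFields.QCD.Theses.GapBuysCauchyRate
open Summit.QuantumFields.QCD.Cruxes.StableActionBridge.Sketch (torusTheta_pseudoscalarBilinear)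

variable {Nf : ℕ}

/-- **Reflection law of the `pseudoRe` insertion** (it does not see the gauge field):
`Θ_T O_{fg}(x) = O_{fg}(θ₀ x)` for `O_{fg} = (P_{fg} + P_{gf})/2`, from
`Θ_T P_{fg}(x) = P_{gf}(θx)`, `Torus.proj (θ₀x) = θ (Torus.proj x)` and `conj (1/2) = 1/2`. -/
private theorem torusTheta_insertion_pseudoRe {L : ℕ} [NeZero L]
    (U V : GaugeConfig 4 L (Matrix.specialUnitaryGroup (Fin 3) ℂ)) (f g : Fin Nf)
    (x : Literature.Probability.LatticeModels.Site 4) :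
    torusTheta (insertion V (QCDField.pseudoRe f g) x) =
      insertion U (QCDField.pseudoRe f g) (siteReflect x) := by
  simp only [insertion, proj_siteReflect, LinearMap.map_smulₛₗ, map_add,
    torusTheta_pseudoscalarBilinear]
  rw [add_comm]
  congr 1
  rw [map_div₀, map_one, map_ofNat]

/-- **Reflection law of the smeared meson field**: `Θ_T Φ_k^P(φ) = Φ_k^P(Θφ)` for
`P = pseudoRe f g` (antilinearity of `Θ_T` on the real coefficients `z a⁴ φ(a x)` and the real
shift, the insertion law `Θ_T O(x) = O(θ₀x)`, and the reindexing `x ↦ θ₀x` of the symmetric box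
with `(Θφ)(a x) = φ(a θ₀ x)`). -/
private theorem torusTheta_smearedInsertion (sch : QCDScheme Nf) (k : ℕ)
    (U V : GaugeConfig 4 (sch.side k) (Matrix.specialUnitaryGroup (Fin 3) ℂ)) (f g : Fin Nf)
    (φ : SchwartzMap (EuclideanSpace ℝ (Fin 4)) ℝ) :
    torusTheta (smearedInsertion sch k V (QCDField.pseudoRe f g) φ) =
      smearedInsertion sch k U (QCDField.pseudoRe f g) (thetaTest 4 φ) := by
  unfold smearedInsertion
  simp only [map_sum, LinearMap.map_smulₛₗ, map_sub, torusTheta_algebraMap, Complex.conj_ofReal,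
    torusTheta_insertion_pseudoRe U V]
  refine Finset.sum_nbij' siteReflect siteReflect (fun x hx => siteReflect_mem_box hx)
    (fun x hx => siteReflect_mem_box hx) (fun x _ => siteReflect_siteReflect x)
    (fun x _ => siteReflect_siteReflect x) fun x _ => ?_
  simp only [thetaTest_apply, timeReflection_smul_siteToE, siteReflect_siteReflect]

/-- The time-periodic quark Boltzmann factor is even, hence central. -/
private theorem fermiBoltzmann_comm {L : ℕ} [NeZero L]
    (U : GaugeConfig 4 L (Matrix.specialUnitaryGroup (Fin 3) ℂ)) (mq : Fin Nf → ℝ)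
    (a : FermiAlg Nf L) : a * fermiBoltzmann U mq = fermiBoltzmann U mq * a :=
  (GrassmannAlgebra.commute_of_mem_evenOdd_zero ℂ
    (GrassmannAlgebra.grassmannExp_quadratic_mem_evenOdd_zero ℂ _) a).eq.symm

/-- **`Θ_T` maps the meson two-point integrand at `U` to the same integrand at `Θ'U`**:
`Θ_T (Φ(Θf₀) Φ(f₀) e^{−ψ̄D(U)ψ}) = Φ(Θf₀) Φ(f₀) e^{−ψ̄D(Θ'U)ψ}` (given the Boltzmann
reflection symmetry: `Θ_T` is antimultiplicative, exchanges `Φ(Θf₀)` and `Φ(f₀)` since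
`ΘΘf₀ = f₀`, and the Boltzmann factor is central). -/
private theorem torusTheta_mesonIntegrand
    (hB : ∀ (Nf L : ℕ) [NeZero L] (U : GaugeConfig 4 L (Matrix.specialUnitaryGroup (Fin 3) ℂ))
      (mq : Fin Nf → ℝ), torusTheta (fermiBoltzmann U mq) = fermiBoltzmann U.negReflect mq)
    (sch : QCDScheme Nf) (k : ℕ) (f g : Fin Nf)
    (f₀ : SchwartzMap (EuclideanSpace ℝ (Fin 4)) ℝ) (mq : Fin Nf → ℝ)
    (U : GaugeConfig 4 (sch.side k) (Matrix.specialUnitaryGroup (Fin 3) ℂ)) :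
    torusTheta (smearedInsertion sch k U (QCDField.pseudoRe f g) (thetaTest 4 f₀) *
        smearedInsertion sch k U (QCDField.pseudoRe f g) f₀ * fermiBoltzmann U mq) =
      smearedInsertion sch k U.negReflect (QCDField.pseudoRe f g) (thetaTest 4 f₀) *
        smearedInsertion sch k U.negReflect (QCDField.pseudoRe f g) f₀ *
          fermiBoltzmann U.negReflect mq := by
  have hθ : thetaTest 4 (thetaTest 4 f₀) = f₀ := thetaTest_involutive 4 f₀
  rw [torusTheta_mul, torusTheta_mul, hB Nf (sch.side k) U mq,
    torusTheta_smearedInsertion sch k U.negReflect U f g f₀,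
    torusTheta_smearedInsertion sch k U.negReflect U f g (thetaTest 4 f₀), hθ,
    ← fermiBoltzmann_comm]

/-- **`N = c · conj N` for reflection-covariant integrands**: if `Θ_T F(U) = F(Θ'U)` for all `U`,
then `∫dμ_W ∫dψ̄dψ F = c · conj (∫dμ_W ∫dψ̄dψ F)` with `c = thetaBerezinConst`
(`fermiIntegral_torusTheta` and the `Θ'`-invariance of Wilson's torus measure). -/
private theorem integral_fermiIntegral_eq_const_mul_conj (sch : QCDScheme Nf) (k : ℕ)
    (F : GaugeConfig 4 (sch.side k) (Matrix.specialUnitaryGroup (Fin 3) ℂ) →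
      FermiAlg Nf (sch.side k))
    (hF : ∀ U, torusTheta (F U) = F U.negReflect) :
    ∫ U, fermiIntegral (F U) ∂(qcdGaugeMeasure sch k) =
      thetaBerezinConst Nf (sch.side k) *
        starRingEnd ℂ (∫ U, fermiIntegral (F U) ∂(qcdGaugeMeasure sch k)) := by
  unfold qcdGaugeMeasure
  rw [← integral_conj, ← integral_const_mul,
    ← integral_comp_negReflect_eq (fundamentalRep (Fin 3)) (continuous_fundamentalRep (Fin 3))
      (sch.β k) fun U => fermiIntegral (F U)]
  refine integral_congr_ae (Filter.Eventually.of_forall fun U => ?_)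
  show fermiIntegral (F U.negReflect) = _
  rw [← hF, fermiIntegral_torusTheta]

/-- (W7b) from W7a: **the meson two-point function on a reflected pair `(Θf₀, f₀)` is real**,
for every scheme, step and flavour pair (Osterwalder–Seiler: numerator and denominator of
`qcdLatticeSchwinger` both satisfy `N = c · conj N`). -/
theorem stub_mesonTwoPointReal :
    (∀ (Nf L : ℕ) [NeZero L] (U : GaugeConfig 4 L (Matrix.specialUnitaryGroup (Fin 3) ℂ))
      (mq : Fin Nf → ℝ), torusTheta (fermiBoltzmann U mq) = fermiBoltzmann U.negReflect mq) →
    ∀ (Nf : ℕ) (sch : QCDScheme Nf) (k : ℕ) (f g : Fin Nf)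
      (f₀ : SchwartzMap (EuclideanSpace ℝ (Fin 4)) ℝ),
      (sch.twoPoint k (QCDField.pseudoRe f g) (QCDField.pseudoRe f g) (thetaTest 4 f₀) f₀).im = 0 := by
  intro hB Nf sch k f g f₀
  rw [QCDScheme.twoPoint_eq]
  unfold qcdLatticeSchwinger
  simp only [List.ofFn_succ, List.ofFn_zero, List.prod_cons, List.prod_nil, mul_one,
    Matrix.cons_val_zero, Matrix.cons_val_succ]
  exact div_im_eq_zero_of_eq_mul_conj
    (integral_fermiIntegral_eq_const_mul_conj sch k _
      (torusTheta_mesonIntegrand hB sch k f g f₀ _))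
    (integral_fermiIntegral_eq_const_mul_conj sch k _ fun U => hB Nf (sch.side k) U _)

end Summit.QuantumFields.QCD.Cruxes.LadderCauchyRate.Birth

end
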